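import Literature.AlgebraicGeometry.GroupSchemes.UnitComponentReductionKernel
import Mathlib.RingTheory.IntegralClosure.IntegrallyClosed
import Mathlib.CategoryTheory.Monoidal.Cartesian.Over
import HarnessLib

/-!
# Points of a FINITE scheme over an integrally closed domain with values in the fraction field are sections: `G(K) = G(R)`
# ([StacksProject] Tag 0BWT ∕ 052K: integrally closed ⇒ fraction-field-valued integral points lie in `R`; [GortzWedhorn2020] (4.1), Tag 01I1)

Topic `Literature/AlgebraicGeometry/GroupSchemes`, namespace `Literature.AlgebraicGeometry.GroupSchemes.UnitComponent`.  THEOREMS ONLY (no definition,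
no named fact, no instance, no notation, no `sorry`).  The INTEGRALLY-CLOSED form of ★ `UnitComponent.existsUnique_section_comp_eq` (which is typed for a
valuation subring `V ⊆ Ω`): here the base is any integrally closed domain `R` with a fraction field `K` given as a type (`IsFractionRing R K` — e.g. a
Dedekind domain ∕ the DVR `𝒪_L`), so that the DICT organ (o-c2l) «reduction on the kernel of an isogeny over `𝒪_L`» (cell `pub/hodgecm-mathlib`, P6 «MOD»,
F0P6c-plan) can read `(Ker φ)(K) = (Ker φ)(𝒪_L)`.  Generic capital `--supports stmt-HodgeConjecture-24832`.  HONEST LABEL: HC_CM is proved only modulo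
the cell's 2 remaining named inputs (hLiu418 24832, h413 24833) until rung 0 closes; this file pays no letter.

* `exists_algHom_equiv_algHom_of_isIntegrallyClosed` — `R` an integrally closed domain, `K` its fraction field, `C` an INTEGRAL `R`-algebra:
  `(C →ₐ[R] R) ≃ (C →ₐ[R] K)` by composing with `R → K` (every `R`-algebra map `C → K` takes integral, hence `R`-rational, values; Mathlib
  `IsIntegrallyClosed.isIntegral_iff`, `IsFractionRing.injective`);
* **`existsUnique_section_comp_eq_of_isIntegrallyClosed`** — for `G → Spec R` FINITE, every `t : Spec K → G` over `Spec R` is `Spec K → Spec R → G`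
  for a UNIQUE section `s : 𝟙_ (Over (Spec R)) ⟶ G` (points dictionary ★ `Morphisms/AffinePointsOverSpec`).

## References
* [StacksProject] The Stacks Project, Tag 052K ∕ Tag 0BWT (integral closure, valuative language), Tag 01I1 (points of affine schemes).
* [GortzWedhorn2020] U. Görtz, T. Wedhorn, *Algebraic Geometry I*, 2nd ed. (2020), Section (4.1) (functor of points), Prop. 12.58-type
  extension of sections over normal bases (here only the trivial finite case).
-/

set_option autoImplicit false

noncomputable section

universe u

open CategoryTheory AlgebraicGeometry MonoidalCategory

namespace Literature.AlgebraicGeometry.GroupSchemes.UnitComponent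

/-! ### §1 Algebra: `(C →ₐ[R] R) ≃ (C →ₐ[R] K)` for `C` integral over the integrally closed domain `R` -/

/-- **`R`-algebra maps from an integral algebra into the fraction field land in `R`** when `R` is integrally closed: composing with
`algebraMap R K` is a bijection `(C →ₐ[R] R) ≃ (C →ₐ[R] K)`, with `e ψ c = algebraMap R K (ψ c)`. [cite: StacksProject, Tag 052K] -/
theorem exists_algHom_equiv_algHom_of_isIntegrallyClosed (R : Type u) [CommRing R] [IsDomain R] [IsIntegrallyClosed R] (K : Type u)
    [Field K] [Algebra R K] [IsFractionRing R K] (C : Type u) [CommRing C] [Algebra R C] [Algebra.IsIntegral R C] :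
    ∃ e : (C →ₐ[R] R) ≃ (C →ₐ[R] K), ∀ ψ c, e ψ c = algebraMap R K (ψ c) := by
  have hint : ∀ (φ : C →ₐ[R] K) (c : C), ∃ r : R, algebraMap R K r = φ c := fun φ c =>
    IsIntegrallyClosed.isIntegral_iff.mp ((Algebra.IsIntegral.isIntegral (R := R) c).map φ)
  have hinj : Function.Injective (algebraMap R K) := IsFractionRing.injective R K
  let back : (C →ₐ[R] K) → (C →ₐ[R] R) := fun φ =>
    { toFun := fun c => (hint φ c).choose
      map_one' := hinj (by rw [(hint φ 1).choose_spec, map_one, map_one])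
      map_mul' := fun a b => hinj (by rw [(hint φ _).choose_spec, map_mul, map_mul, (hint φ a).choose_spec, (hint φ b).choose_spec])
      map_zero' := hinj (by rw [(hint φ 0).choose_spec, map_zero, map_zero])
      map_add' := fun a b => hinj (by rw [(hint φ _).choose_spec, map_add, map_add, (hint φ a).choose_spec, (hint φ b).choose_spec])
      commutes' := fun r => hinj (by rw [(hint φ _).choose_spec, AlgHom.commutes, Algebra.algebraMap_self_apply]) }
  have hback : ∀ φ c, algebraMap R K (back φ c) = φ c := fun φ c => (hint φ c).choose_spec
  refine ⟨{ toFun := fun ψ => (IsScalarTower.toAlgHom R R K).comp ψ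
            invFun := back
            left_inv := fun ψ => ?_
            right_inv := fun φ => ?_ }, fun ψ c => rfl⟩
  · apply AlgHom.ext; intro c
    exact hinj (by rw [hback]; rfl)
  · apply AlgHom.ext; intro c
    exact hback φ c

/-! ### §2 `G(K) = G(R)` for `G` finite over the integrally closed domain `R` -/

/-- **`G(K) = G(R)` for `G` finite over an integrally closed domain `R` with fraction field `K`.**  Every `t : Spec K → G` over `Spec R` factors
as `Spec K → Spec R → G` through a UNIQUE section `s : 𝟙_ ⟶ G`: the ring map `Γ(G, 𝒪) → K` of `t` takes values in `R` (`Γ(G, 𝒪)` is module-finite,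
hence integral, over `R`), and `R → K` is injective. [cite: StacksProject, Tag 052K] [cite: StacksProject, Tag 01I1] -/
theorem existsUnique_section_comp_eq_of_isIntegrallyClosed (R : Type u) [CommRing R] [IsDomain R] [IsIntegrallyClosed R] (K : Type u)
    [Field K] [Algebra R K] [IsFractionRing R K] (G : Over (Spec (CommRingCat.of R))) [IsFinite G.hom]
    (t : Spec (CommRingCat.of K) ⟶ G.left) (ht : t ≫ G.hom = Spec.map (CommRingCat.ofHom (algebraMap R K))) :
    ∃! s : 𝟙_ (Over (Spec (CommRingCat.of R))) ⟶ G, Spec.map (CommRingCat.ofHom (algebraMap R K)) ≫ s.left = t := by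
  haveI : IsAffine G.left := isAffine_of_isAffineHom G.hom
  set φ : CommRingCat.of R ⟶ Γ(G.left, ⊤) := (Scheme.ΓSpecIso (.of R)).inv ≫ G.hom.appTop with hφ
  letI : Algebra R Γ(G.left, ⊤) := φ.hom.toAlgebra
  haveI : Module.Finite R Γ(G.left, ⊤) := finite_structureRingHom G
  haveI : Algebra.IsIntegral R Γ(G.left, ⊤) := Algebra.IsIntegral.of_finite _ _
  -- charts of points over `Spec R` are ring maps under `R`
  have chart : ∀ {S : CommRingCat.{u}} (g : CommRingCat.of R ⟶ S) (z : Spec S ⟶ G.left), z ≫ G.hom = Spec.map g →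
      (z.appTop ≫ (Scheme.ΓSpecIso S).hom).hom.comp (algebraMap R Γ(G.left, ⊤)) = g.hom := by
    intro S g z hz
    have h := (Literature.AlgebraicGeometry.Morphisms.comp_eq_specMap_iff G.hom g z).mp hz
    have h' := congrArg CommRingCat.Hom.hom h
    simp only [CommRingCat.hom_comp] at h'
    rw [RingHom.algebraMap_toAlgebra, hφ, CommRingCat.hom_comp]
    exact h'
  let χ : Γ(G.left, ⊤) →ₐ[R] K :=
    AlgHom.mk (t.appTop ≫ (Scheme.ΓSpecIso (.of K)).hom).hom fun r => RingHom.congr_fun (chart _ t ht) r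
  obtain ⟨e, he⟩ := exists_algHom_equiv_algHom_of_isIntegrallyClosed R K Γ(G.left, ⊤)
  set ψ : Γ(G.left, ⊤) →ₐ[R] R := e.symm χ with hψ
  have hψχ : ∀ c, algebraMap R K (ψ c) = χ c := fun c => by rw [← he ψ c, hψ, Equiv.apply_symm_apply]
  -- the section
  let s₀ : Spec (CommRingCat.of R) ⟶ G.left := Spec.map (CommRingCat.ofHom ψ.toRingHom) ≫ G.left.isoSpec.inv
  have hs₀chart : s₀.appTop ≫ (Scheme.ΓSpecIso (.of R)).hom = CommRingCat.ofHom ψ.toRingHom :=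
    Literature.AlgebraicGeometry.Morphisms.appTop_specMap_comp_isoSpec_inv_comp_ΓSpecIso_hom _
  have hs₀ : s₀ ≫ G.hom = 𝟙 (Spec (CommRingCat.of R)) := by
    rw [← Spec.map_id]
    refine (Literature.AlgebraicGeometry.Morphisms.comp_eq_specMap_iff G.hom (𝟙 (CommRingCat.of R)) s₀).mpr ?_
    rw [hs₀chart]
    apply CommRingCat.hom_ext
    exact RingHom.ext fun r => ψ.commutes r
  have chartK : ∀ u : Spec (CommRingCat.of R) ⟶ G.left,
      (Spec.map (CommRingCat.ofHom (algebraMap R K)) ≫ u).appTop ≫ (Scheme.ΓSpecIso (.of K)).hom =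
        (u.appTop ≫ (Scheme.ΓSpecIso (.of R)).hom) ≫ CommRingCat.ofHom (algebraMap R K) := by
    intro u
    conv_lhs => rw [← Literature.AlgebraicGeometry.Morphisms.specMap_appTop_comp_ΓSpecIso_hom_comp_isoSpec_inv u, ← Category.assoc,
      ← Spec.map_comp]
    exact Literature.AlgebraicGeometry.Morphisms.appTop_specMap_comp_isoSpec_inv_comp_ΓSpecIso_hom _
  refine ⟨Over.homMk s₀ hs₀, ?_, fun s' hs' => ?_⟩
  · change Spec.map (CommRingCat.ofHom (algebraMap R K)) ≫ s₀ = t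
    apply Literature.AlgebraicGeometry.Morphisms.bijective_appTop_comp_ΓSpecIso_hom.1
    change (Spec.map (CommRingCat.ofHom (algebraMap R K)) ≫ s₀).appTop ≫ _ = t.appTop ≫ _
    rw [chartK s₀, hs₀chart]
    apply CommRingCat.hom_ext
    exact RingHom.ext fun c => hψχ c
  · apply Over.OverMorphism.ext
    change s'.left = s₀
    apply Literature.AlgebraicGeometry.Morphisms.bijective_appTop_comp_ΓSpecIso_hom.1
    change s'.left.appTop ≫ _ = s₀.appTop ≫ _
    rw [hs₀chart]
    apply CommRingCat.hom_ext
    refine RingHom.ext fun c => IsFractionRing.injective R K ?_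
    have h1 := congrArg (fun k : Spec (CommRingCat.of K) ⟶ G.left => (k.appTop ≫ (Scheme.ΓSpecIso (.of K)).hom).hom c) hs'
    simp only [chartK s'.left, CommRingCat.hom_comp, CommRingCat.hom_ofHom, RingHom.comp_apply] at h1
    exact h1.trans (hψχ c).symm

end Literature.AlgebraicGeometry.GroupSchemes.UnitComponent

end
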